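import Summits.CriticalPhenomena.PercolationContinuityZ3.Theorems.PercNearOneGluingNoHeavyQuantOneBigCert
import Summits.CriticalPhenomena.PercolationContinuityZ3.Theorems.PercNearOneGluingNoHeavyQuantTwoBigJ
import Summits.CriticalPhenomena.PercolationContinuityZ3.Theorems.PercNearOneGluingNoHeavyQuantTwoBigJFinalA
import Summits.CriticalPhenomena.PercolationContinuityZ3.Theorems.PercNearOneGluingNoHeavyQuantTwoBigJFinalB
import Summits.CriticalPhenomena.PercolationContinuityZ3.Theorems.PercNearOneGluingNoHeavyQuantTwoBigJFinalC
import Summits.CriticalPhenomena.PercolationContinuityZ3.Theorems.PercNearOneGluingNoHeavyQuantTwoBigJFinalD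
import HarnessLib

/-!
# QUANT lane R8, Conjecture DIB\* — the j-cloud TWO-BIG certificate: `TwoBigCertJ` HOLDS, hence T-DIB (`∀ x < 1, DIBStar x`)

builds on p205010 (kernel theorem, internal audit signed; external expert review pending)

Support file (`--supports stmt-CriticalPhenomena-4575`), QUANT lane seat prim-quant-p1 (gen 13, owner of `TwoBigCertJ` per README V232).
Theorems only (pure real algebra); no sorries, standard axioms.  Machine-generated by `work/num/genfinal.py` / `genfinalfiles.py` (p1 g13 folder,
copied to `run/shared/lean/prim/quant/prim-quant-p1-g13/`).

THE PROOF OF `IndepBlob.TwoBigCertJ` (`…QuantTwoBigJ`, p284090): **`twoBigCertJ_holds`**, hence **`dibStar_holds : ∀ x < 1, DIBStar x`**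
(T-DIB, the single probabilistic ingredient of the R8 architecture of record, README V185) via `dibStar_of_twoBigCertJ`, and lead g19's
honest-F2 certificate `twoBigCert_holds : TwoBigCert` via `twoBigCert_of_J`.
Steps (as in lead g19's `…QuantOneBigCert`): the cloud aggregates are eliminated by `OneBigIneq.markov_chain` / `OneBigIneq.level_bound` with the
Cantelli constant `k = j(1−x)` (cloud sizes `≤ j`), leaving bounds `F0, F1, F2` on the three cloud terms that depend only on the normalised
cloud credit `c = 2 − α₁φ₁ − α₂φ₂ = l₁ + l₂ + e₁ + e₂` and the levels; the inequality `F1·q2 + F2·q1 + (F0 − F1 − F2)·q1·q2 ≤ 1 − x` is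
`TwoBigFinal.final_<region>` (`…QuantTwoBigJFinalA/B`: segment reduction + 42 Handelman leaves).  NUMERICS of record: infimum margin
`0.122(1−x)` (p1 g13 INBOX 13:35Z/15:05Z).
[this work]
-/

namespace Summit.CriticalPhenomena.PercolationContinuityZ3.Theorems
namespace Quant
namespace IndepBlob

namespace TwoBigJProof

open TwoBigFinal

/-- The normalised Cantelli value: `kC/(kC + (C − L)²) = yc/(yc + (c − l)²)` for `k = jy`, `C = jc`, `L = jl`, `j > 0`. [this work] -/
theorem cant_norm (j y c l : ℝ) (hj : 0 < j) (hD : 0 < y * c + (c - l) ^ 2) :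
    (j * y) * (j * c) / ((j * y) * (j * c) + (j * c - j * l) ^ 2) = y * c / (y * c + (c - l) ^ 2) := by
  have hj2 : 0 < j ^ 2 := by positivity
  have hD' : 0 < (j * y) * (j * c) + (j * c - j * l) ^ 2 := by
    have e : (j * y) * (j * c) + (j * c - j * l) ^ 2 = j ^ 2 * (y * c + (c - l) ^ 2) := by ring
    rw [e]; positivity
  rw [div_eq_div_iff hD'.ne' hD.ne']
  ring

/-- The normalised Markov value: `(1−x)C/(C − xL) = yc/(c − (1−y)l)` for `C = jc`, `L = jl`, `x = 1 − y`, `j > 0`. [this work] -/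
theorem mark_norm (j y c l : ℝ) (hj : 0 < j) (hD : 0 < c - (1 - y) * l) :
    (1 - (1 - y)) * (j * c) / (j * c - (1 - y) * (j * l)) = y * c / (c - (1 - y) * l) := by
  have hD' : 0 < j * c - (1 - y) * (j * l) := by
    have e : j * c - (1 - y) * (j * l) = j * (c - (1 - y) * l) := by ring
    rw [e]; positivity
  rw [div_eq_div_iff hD'.ne' hD.ne']
  ring

/-- The type data of one conditioned blob: gate `p ∈ [x², 1]`, relative size `1 − l`, credit rate `φ`; its defect mass `e` with
`(1 − l)φ = (1 − l) − e`, and the heavy (`x ≤ p`: closure `= e/(1−l) ≤ y`) or light (`p < x`: closure `= y((1−y) + e/(1−l))`) relations. [this work] -/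
theorem blob_data (y p l φ : ℝ) (hy : 0 < y) (hxp : (1 - y) ^ 2 ≤ p) (hp1 : p ≤ 1) (hl1 : l < 1)
    (hφ : (if 1 - y ≤ p then p else (p - (1 - y) ^ 2) / (1 - (1 - y))) = φ) :
    ∃ e : ℝ, (1 - l) * φ = (1 - l) - e ∧ 0 ≤ e ∧ e ≤ 1 - l ∧
      ((0 ≤ e ∧ e ≤ (1 - l) * y ∧ (1 - l) * (1 - p) = e) ∨
       ((1 - l) * y ≤ e ∧ e ≤ 1 - l ∧ (1 - l) * (1 - p) = y * ((1 - y) * (1 - l) + e))) := by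
  have hα : 0 < 1 - l := by linarith
  by_cases h : 1 - y ≤ p
  · rw [if_pos h] at hφ
    subst hφ
    refine ⟨(1 - l) * (1 - p), by ring, by nlinarith, by nlinarith, Or.inl ⟨by nlinarith, by nlinarith, rfl⟩⟩
  · rw [if_neg h] at hφ
    have hy1 : (1 : ℝ) - (1 - y) = y := by ring
    rw [hy1] at hφ
    have hφy : φ * y = p - (1 - y) ^ 2 := by rw [← hφ]; field_simp
    have hφ0 : 0 ≤ φ := by rw [← hφ]; exact div_nonneg (by linarith) hy.le
    have hφx : φ ≤ 1 - y := by
      by_contra hc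
      push Not at hc
      nlinarith [not_le.1 h]
    refine ⟨(1 - l) * (1 - φ), by ring, by nlinarith, by nlinarith, Or.inr ⟨by nlinarith, by nlinarith, ?_⟩⟩
    have : 1 - p = y * ((1 - y) + (1 - φ)) := by nlinarith
    rw [this]; ring

set_option maxHeartbeats 1600000 in
/-- **`TwoBigCertJAt b₁ b₂ j` HOLDS for all sizes.**  Chains of `…QuantOneBigCert` (`markov_chain`, `level_bound` with `k = j(1−x)`), then the
region dispatch `TwoBigFinal.final_*` (segment reduction + Handelman leaves). [this work] -/
theorem twoBigCertJAt_holds (b₁ b₂ j : ℕ) : TwoBigCertJAt b₁ b₂ j := by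
  intro x p₁ p₂ A m s2 V c hx hx1 hp₁ hp₁1 hp₂ hp₂1 hjb₁ hb₁j hjb₂ hb₂j hcred hcm hclosed hmA hV0 hs20 hs2c _hs2m _hs2E hVj
  generalize hφ₁ : (if x ≤ p₁ then p₁ else (p₁ - x ^ 2) / (1 - x)) = φ₁ at hcred
  generalize hφ₂ : (if x ≤ p₂ then p₂ else (p₂ - x ^ 2) / (1 - x)) = φ₂ at hcred
  obtain ⟨y, rfl⟩ : ∃ y : ℝ, x = 1 - y := ⟨1 - x, by ring⟩
  have hy : 0 < y := by linarith
  have hy2 : 0 ≤ (1 / 2 : ℝ) + (-1 : ℝ) * y := by linarith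
  -- sizes
  have hb1 : 1 ≤ b₁ := by omega
  have hj1 : 1 ≤ j := le_trans hb1 hb₁j
  have hjr : (0 : ℝ) < j := by exact_mod_cast (lt_of_lt_of_le Nat.zero_lt_one hj1)
  obtain ⟨l1, hl1e⟩ : ∃ l1 : ℝ, l1 = 1 - (b₁ : ℝ) / j := ⟨_, rfl⟩
  obtain ⟨l2, hl2e⟩ : ∃ l2 : ℝ, l2 = 1 - (b₂ : ℝ) / j := ⟨_, rfl⟩
  have hb1e : (b₁ : ℝ) = j * (1 - l1) := by rw [hl1e]; field_simp; ring
  have hb2e : (b₂ : ℝ) = j * (1 - l2) := by rw [hl2e]; field_simp; ring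
  have hL1 : ((j - b₁ : ℕ) : ℝ) = j * l1 := by rw [Nat.cast_sub hb₁j, hb1e]; ring
  have hL2 : ((j - b₂ : ℕ) : ℝ) = j * l2 := by rw [Nat.cast_sub hb₂j, hb2e]; ring
  have hl1 : 0 ≤ l1 := by
    rw [hl1e, sub_nonneg, div_le_one hjr]; exact_mod_cast hb₁j
  have hl2 : 0 ≤ l2 := by
    rw [hl2e, sub_nonneg, div_le_one hjr]; exact_mod_cast hb₂j
  have hl1s : l1 < 1 / 2 := by
    have h : (j : ℝ) < 2 * b₁ := by exact_mod_cast hjb₁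
    rw [hl1e]; rw [show (1:ℝ) - b₁ / j = (j - b₁) / j from by field_simp]
    rw [div_lt_iff₀ hjr]; linarith
  have hl2s : l2 < 1 / 2 := by
    have h : (j : ℝ) < 2 * b₂ := by exact_mod_cast hjb₂
    rw [hl2e]; rw [show (1:ℝ) - b₂ / j = (j - b₂) / j from by field_simp]
    rw [div_lt_iff₀ hjr]; linarith
  have hl1' : 0 ≤ (1 / 2 : ℝ) + (-1 : ℝ) * l1 := by linarith
  have hl2' : 0 ≤ (1 / 2 : ℝ) + (-1 : ℝ) * l2 := by linarith
  -- blob data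
  obtain ⟨e1, hφe1, he1a, he1b, h1⟩ := blob_data y p₁ l1 φ₁ hy hp₁ hp₁1 (by linarith) hφ₁
  obtain ⟨e2, hφe2, he2a, he2b, h2⟩ := blob_data y p₂ l2 φ₂ hy hp₂ hp₂1 (by linarith) hφ₂
  -- the normalised cloud credit lower bound and its j-multiple
  obtain ⟨cn, hce⟩ : ∃ cn : ℝ, cn = l1 + l2 + e1 + e2 := ⟨_, rfl⟩
  have hC : (j : ℝ) * cn = 2 * j - b₁ * φ₁ - b₂ * φ₂ := by
    rw [hce, hb1e, hb2e]
    have e1' : (j : ℝ) * (1 - l1) * φ₁ = j * ((1 - l1) - e1) := by rw [← hφe1]; ring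
    have e2' : (j : ℝ) * (1 - l2) * φ₂ = j * ((1 - l2) - e2) := by rw [← hφe2]; ring
    linarith [e1', e2']
  have hCc : (j : ℝ) * cn < c := by linarith
  have hcn0 : 0 ≤ cn := by rw [hce]; linarith
  -- closures and the reduction of the goal to `p₁q₂T₁ + q₁p₂T₂ + q₁q₂T₀ ≤ y`
  have hq1 : 0 ≤ 1 - p₁ := by linarith
  have hq2 : 0 ≤ 1 - p₂ := by linarith
  have hp1 : 0 ≤ p₁ := le_trans (sq_nonneg _) hp₁
  have hp2 : 0 ≤ p₂ := le_trans (sq_nonneg _) hp₂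
  -- degenerate case cn = 0: both blobs sure
  by_cases hcz : cn = 0
  · have he1z : e1 = 0 := by linarith
    have he2z : e2 = 0 := by linarith
    have hq1z : 1 - p₁ = 0 := by
      rcases h1 with ⟨_, _, hq⟩ | ⟨ha, _, _⟩
      · have : (1 - l1) * (1 - p₁) = 0 := by rw [hq, he1z]
        rcases mul_eq_zero.1 this with h | h
        · exfalso; linarith
        · exact h
      · exfalso; linarith [mul_pos (show (0:ℝ) < 1 - l1 by linarith) hy]
    have hq2z : 1 - p₂ = 0 := by
      rcases h2 with ⟨_, _, hq⟩ | ⟨ha, _, _⟩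
      · have : (1 - l2) * (1 - p₂) = 0 := by rw [hq, he2z]
        rcases mul_eq_zero.1 this with h | h
        · exfalso; linarith
        · exact h
      · exfalso; linarith [mul_pos (show (0:ℝ) < 1 - l2 by linarith) hy]
    refine ⟨0, 0, 0, Or.inl le_rfl, Or.inl le_rfl, Or.inl le_rfl, ?_⟩
    rw [show p₁ = 1 by linarith, show p₂ = 1 by linarith]; norm_num; linarith
  have hcn : 0 < cn := lt_of_le_of_ne hcn0 (Ne.symm hcz)
  have hCpos : 0 < (j : ℝ) * cn := mul_pos hjr hcn
  have hmC : (j : ℝ) * cn < m := hCc.trans_le hcm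
  have hAC : (j : ℝ) * cn < A := hmC.trans_le hmA
  -- cloud chains
  have hE1 : A - m ≤ A - j * cn := by linarith
  have hyc : y * ((j : ℝ) * cn) < y * c := mul_lt_mul_of_pos_left hCc hy
  have hE2 : A - m ≤ (1 - (1 - y)) * ((1 + (1 - y)) * A - j * cn) := by nlinarith [hyc, hclosed]
  have hW : V ≤ ((j : ℝ) * y) * (2 * m - j * cn) := by
    have e : (1 : ℝ) - (1 - y) = y := by ring
    rw [e] at hs2c
    have h1 : s2 ≤ y * (2 * m - j * cn) := by nlinarith [hyc, hs2c]
    have h2 := mul_le_mul_of_nonneg_left h1 hjr.le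
    nlinarith [hVj, h2]
  have hk : 0 < (j : ℝ) * y := mul_pos hjr hy
  -- Cantelli at any admissible level
  have cant : ∀ l : ℝ, 0 ≤ l → l ≤ cn →
      V / (V + (m - j * l) ^ 2) ≤ y * cn / (y * cn + (cn - l) ^ 2) := by
    intro l hl0 hlc
    have hD : 0 < y * cn + (cn - l) ^ 2 := by nlinarith [sq_nonneg (cn - l)]
    refine OneBigIneq.level_bound V ((j : ℝ) * y) (j * cn) m (j * l) _ hV0 hW hk (by positivity) (mul_le_mul_of_nonneg_left hlc hjr.le) hmC hCpos ?_
    exact cant_norm j y cn l hjr hD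
  -- Markov on the closed mass at an admissible level
  have mark : ∀ l : ℝ, 0 < l → l ≤ cn → cn ≤ (2 - y) * l →
      (A - m) / (A - j * l) ≤ y * cn / (cn - (1 - y) * l) := by
    intro l hl0 hlc hcl
    have hD : 0 < cn - (1 - y) * l := by nlinarith [mul_pos hy hl0]
    have hjl : (j : ℝ) * l ≤ j * cn := mul_le_mul_of_nonneg_left hlc hjr.le
    have hjl2 : (j : ℝ) * cn ≤ j * ((2 - y) * l) := mul_le_mul_of_nonneg_left hcl hjr.le
    have h := OneBigIneq.markov_chain (1 - y) A (j * cn) (j * l) (A - m) (by linarith) (by linarith) hjl (by linarith) (by positivity) hE1 hE2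
    rw [mark_norm j y cn l hjr hD] at h
    exact h
  -- the reduction of the conclusion: it suffices that p₁q₂T₁ + q₁p₂T₂ + q₁q₂T₀ ≤ y with menu values Tᵢ and z = 1 − T
  have hl1c : l1 ≤ cn := by rw [hce]; linarith
  have hl2c : l2 ≤ cn := by rw [hce]; linarith
  have hjl1 : (j : ℝ) * l1 ≤ j * cn := mul_le_mul_of_nonneg_left hl1c hjr.le
  have hjl2 : (j : ℝ) * l2 ≤ j * cn := mul_le_mul_of_nonneg_left hl2c hjr.le
  have hm1 : ((j - b₁ : ℕ) : ℝ) < m := by rw [hL1]; linarith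
  have hm2 : ((j - b₂ : ℕ) : ℝ) < m := by rw [hL2]; linarith
  -- Cantelli values at the help levels (always valid)
  have hT1c := cant l1 hl1 hl1c
  have hT2c := cant l2 hl2 hl2c
  rw [← hL1] at hT1c
  rw [← hL2] at hT2c
  -- common positivity
  have hycn : 0 < y * cn := mul_pos hy hcn
  have hD1 : 0 < cn ^ (2:ℕ) + (-2 : ℝ) * l1 * cn + l1 ^ (2:ℕ) + y * cn := by nlinarith [sq_nonneg (cn - l1), hycn]
  have hD2 : 0 < cn ^ (2:ℕ) + (-2 : ℝ) * l2 * cn + l2 ^ (2:ℕ) + y * cn := by nlinarith [sq_nonneg (cn - l2), hycn]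
  have eD1 : y * cn + (cn - l1) ^ 2 = cn ^ (2:ℕ) + (-2 : ℝ) * l1 * cn + l1 ^ (2:ℕ) + y * cn := by ring
  have eD2 : y * cn + (cn - l2) ^ 2 = cn ^ (2:ℕ) + (-2 : ℝ) * l2 * cn + l2 ^ (2:ℕ) + y * cn := by ring
  -- CONCLUDE from bounds T₁ ≤ F1, T₂ ≤ F2, T₀ ≤ F0 and the final inequality on the F's
  have conclude : ∀ (T1 T2 T0 F1 F2 F0 : ℝ), T1 ≤ F1 → T2 ≤ F2 → T0 ≤ F0 →
      F1 * (1 - p₂) + F2 * (1 - p₁) + (F0 - F1 - F2) * ((1 - p₁) * (1 - p₂)) ≤ y →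
      1 - y ≤ p₁ * p₂ + p₁ * (1 - p₂) * (1 - T1) + (1 - p₁) * p₂ * (1 - T2) + (1 - p₁) * (1 - p₂) * (1 - T0) := by
    intro T1 T2 T0 F1 F2 F0 h1 h2 h0 hfin
    have e1 := mul_le_mul_of_nonneg_left h1 (mul_nonneg hp1 hq2)
    have e2 := mul_le_mul_of_nonneg_left h2 (mul_nonneg hq1 hp2)
    have e0 := mul_le_mul_of_nonneg_left h0 (mul_nonneg hq1 hq2)
    linarith [e1, e2, e0, hfin]
  -- REGION SPLIT
  by_cases hR0 : cn < 1
  · by_cases hP : l2 ≤ l1 ∧ cn ≤ (2 - y) * l1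
    · -- region RM2p: Markov at the help level of blob 1
      have hl1pos : 0 < l1 := by linarith [hP.2, mul_nonneg hy.le hl1, hcn]
      have hT1m := mark l1 hl1pos hl1c hP.2
      have hDm : 0 < cn + (-1 : ℝ) * l1 + y * l1 := by linarith [mul_pos hy hl1pos]
      have hA1 : ((j - b₁ : ℕ) : ℝ) < A := by rw [hL1]; linarith
      rw [← hL1] at hT1m
      refine ⟨1 - (A - m) / (A - ((j - b₁ : ℕ) : ℝ)), 1 - V / (V + (m - ((j - b₂ : ℕ) : ℝ)) ^ 2), 1 - 1,
        Or.inr (Or.inl ⟨hA1, le_rfl⟩), Or.inr (Or.inr ⟨hm2, le_rfl⟩), Or.inl (by norm_num), ?_⟩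
      refine conclude _ _ _ (y * cn / (cn + (-1 : ℝ) * l1 + y * l1)) (y * cn / (cn ^ (2:ℕ) + (-2 : ℝ) * l2 * cn + l2 ^ (2:ℕ) + y * cn)) 1 ?_ ?_ le_rfl ?_
      · refine hT1m.trans (le_of_eq ?_); congr 1; ring
      · rw [← eD2]; exact hT2c
      exact final_RM2p y l1 l2 e1 e2 (1 - p₁) (1 - p₂) cn 1 _ _ hy hy2 hl1 hl1' hl2 hl2' hcn hce (by linarith [hP.1]) (by linarith [hP.2])
        (by norm_num) (div_mul_cancel₀ _ hDm.ne') (div_mul_cancel₀ _ hD2.ne') h1 h2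
    · by_cases hQ : l1 ≤ l2 ∧ cn ≤ (2 - y) * l2
      · -- region RM2f: Markov at the help level of blob 2
        have hl2pos : 0 < l2 := by linarith [hQ.2, mul_nonneg hy.le hl2, hcn]
        have hT2m := mark l2 hl2pos hl2c hQ.2
        have hDm : 0 < cn + (-1 : ℝ) * l2 + y * l2 := by linarith [mul_pos hy hl2pos]
        have hA2 : ((j - b₂ : ℕ) : ℝ) < A := by rw [hL2]; linarith
        rw [← hL2] at hT2m
        refine ⟨1 - V / (V + (m - ((j - b₁ : ℕ) : ℝ)) ^ 2), 1 - (A - m) / (A - ((j - b₂ : ℕ) : ℝ)), 1 - 1,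
          Or.inr (Or.inr ⟨hm1, le_rfl⟩), Or.inr (Or.inl ⟨hA2, le_rfl⟩), Or.inl (by norm_num), ?_⟩
        refine conclude _ _ _ (y * cn / (cn ^ (2:ℕ) + (-2 : ℝ) * l1 * cn + l1 ^ (2:ℕ) + y * cn)) (y * cn / (cn + (-1 : ℝ) * l2 + y * l2)) 1 ?_ ?_ le_rfl ?_
        · rw [← eD1]; exact hT1c
        · refine hT2m.trans (le_of_eq ?_); congr 1; ring
        exact final_RM2f y l1 l2 e1 e2 (1 - p₁) (1 - p₂) cn 1 _ _ hy hy2 hl1 hl1' hl2 hl2' hcn hce (by linarith [hQ.1]) (by linarith [hQ.2])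
          (by norm_num) (div_mul_cancel₀ _ hD1.ne') (div_mul_cancel₀ _ hDm.ne') h1 h2
      · -- region RC0: Cantelli at both help levels, nothing at level j
        have hr1 : 0 ≤ cn + (-2 : ℝ) * l1 + y * l1 := by
          by_contra hcon; push Not at hcon
          have h2y : (0:ℝ) ≤ 2 - y := by linarith
          rcases le_total l2 l1 with h | h
          · exact hP ⟨h, by linarith⟩
          · exact hQ ⟨h, by linarith [mul_nonneg h2y (sub_nonneg.2 h)]⟩
        have hr2 : 0 ≤ cn + (-2 : ℝ) * l2 + y * l2 := by
          by_contra hcon; push Not at hcon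
          have h2y : (0:ℝ) ≤ 2 - y := by linarith
          rcases le_total l1 l2 with h | h
          · exact hQ ⟨h, by linarith⟩
          · exact hP ⟨h, by linarith [mul_nonneg h2y (sub_nonneg.2 h)]⟩
        refine ⟨1 - V / (V + (m - ((j - b₁ : ℕ) : ℝ)) ^ 2), 1 - V / (V + (m - ((j - b₂ : ℕ) : ℝ)) ^ 2), 1 - 1,
          Or.inr (Or.inr ⟨hm1, le_rfl⟩), Or.inr (Or.inr ⟨hm2, le_rfl⟩), Or.inl (by norm_num), ?_⟩
        refine conclude _ _ _ (y * cn / (cn ^ (2:ℕ) + (-2 : ℝ) * l1 * cn + l1 ^ (2:ℕ) + y * cn)) (y * cn / (cn ^ (2:ℕ) + (-2 : ℝ) * l2 * cn + l2 ^ (2:ℕ) + y * cn)) 1 ?_ ?_ le_rfl ?_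
        · rw [← eD1]; exact hT1c
        · rw [← eD2]; exact hT2c
        exact final_RC0 y l1 l2 e1 e2 (1 - p₁) (1 - p₂) cn 1 _ _ hy hy2 hl1 hl1' hl2 hl2' hcn hce hr1 hr2 hR0
          (by norm_num) (div_mul_cancel₀ _ hD1.ne') (div_mul_cancel₀ _ hD2.ne') h1 h2
  · have hcn1 : 1 ≤ cn := not_lt.1 hR0
    have hj1' : (j : ℝ) * 1 ≤ j * cn := mul_le_mul_of_nonneg_left hcn1 hjr.le
    have hjA : (j : ℝ) < A := by linarith
    have hjm : (j : ℝ) < m := by linarith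
    by_cases hR1 : cn ≤ 2 - y
    · -- region RM0: Markov at level j
      have hj2 : (j : ℝ) * cn ≤ j * (2 - y) := mul_le_mul_of_nonneg_left hR1 hjr.le
      have hT0 := OneBigIneq.markov_chain (1 - y) A (j * cn) j (A - m) (by linarith) hjA (by linarith) (by linarith) hjr hE1 hE2
      have hD0 : 0 < (-1 : ℝ) + cn + y := by linarith
      have e0 : (1 - (1 - y)) * (j * cn) / (j * cn - (1 - y) * j) = y * cn / ((-1 : ℝ) + cn + y) := by
        have hne : (j : ℝ) * cn - (1 - y) * j ≠ 0 := by
          have : (j : ℝ) * cn - (1 - y) * j = j * ((-1 : ℝ) + cn + y) := by ring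
          rw [this]; positivity
        rw [div_eq_div_iff hne hD0.ne']; ring
      rw [e0] at hT0
      refine ⟨1 - V / (V + (m - ((j - b₁ : ℕ) : ℝ)) ^ 2), 1 - V / (V + (m - ((j - b₂ : ℕ) : ℝ)) ^ 2), 1 - (A - m) / (A - j),
        Or.inr (Or.inr ⟨hm1, le_rfl⟩), Or.inr (Or.inr ⟨hm2, le_rfl⟩), Or.inr (Or.inl ⟨hjA, le_rfl⟩), ?_⟩
      refine conclude _ _ _ (y * cn / (cn ^ (2:ℕ) + (-2 : ℝ) * l1 * cn + l1 ^ (2:ℕ) + y * cn)) (y * cn / (cn ^ (2:ℕ) + (-2 : ℝ) * l2 * cn + l2 ^ (2:ℕ) + y * cn))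
        (y * cn / ((-1 : ℝ) + cn + y)) ?_ ?_ hT0 ?_
      · rw [← eD1]; exact hT1c
      · rw [← eD2]; exact hT2c
      exact final_RM0 y l1 l2 e1 e2 (1 - p₁) (1 - p₂) cn _ _ _ hy hy2 hl1 hl1' hl2 hl2' hcn hce (by linarith) (by linarith)
        (div_mul_cancel₀ _ hD0.ne') (div_mul_cancel₀ _ hD1.ne') (div_mul_cancel₀ _ hD2.ne') h1 h2
    · -- region RC: Cantelli at level j
      have hcn2 : 2 - y < cn := not_le.1 hR1
      have hT0 := cant 1 zero_le_one hcn1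
      have hD0 : 0 < (1 : ℝ) + (-2 : ℝ) * cn + cn ^ (2:ℕ) + y * cn := by linarith [sq_nonneg (cn - 1), hycn]
      have e0 : y * cn / (y * cn + (cn - 1) ^ 2) = y * cn / ((1 : ℝ) + (-2 : ℝ) * cn + cn ^ (2:ℕ) + y * cn) := by
        congr 1; ring
      rw [e0, mul_one] at hT0
      have hcn2' : cn ≤ 2 := by rw [hce]; linarith
      refine ⟨1 - V / (V + (m - ((j - b₁ : ℕ) : ℝ)) ^ 2), 1 - V / (V + (m - ((j - b₂ : ℕ) : ℝ)) ^ 2), 1 - V / (V + (m - j) ^ 2),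
        Or.inr (Or.inr ⟨hm1, le_rfl⟩), Or.inr (Or.inr ⟨hm2, le_rfl⟩), Or.inr (Or.inr ⟨hjm, le_rfl⟩), ?_⟩
      refine conclude _ _ _ (y * cn / (cn ^ (2:ℕ) + (-2 : ℝ) * l1 * cn + l1 ^ (2:ℕ) + y * cn)) (y * cn / (cn ^ (2:ℕ) + (-2 : ℝ) * l2 * cn + l2 ^ (2:ℕ) + y * cn))
        (y * cn / ((1 : ℝ) + (-2 : ℝ) * cn + cn ^ (2:ℕ) + y * cn)) ?_ ?_ hT0 ?_
      · rw [← eD1]; exact hT1c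
      · rw [← eD2]; exact hT2c
      exact final_RC y l1 l2 e1 e2 (1 - p₁) (1 - p₂) cn _ _ _ hy hy2 hl1 hl1' hl2 hl2' hcn hce hcn2 hcn2'
        (div_mul_cancel₀ _ hD0.ne') (div_mul_cancel₀ _ hD1.ne') (div_mul_cancel₀ _ hD2.ne') h1 h2

/-- **`TwoBigCertJ` HOLDS.** [this work] -/
theorem twoBigCertJ_holds : TwoBigCertJ := fun b₁ b₂ j => twoBigCertJAt_holds b₁ b₂ j

end TwoBigJProof


/-- **`TwoBigCertJ` holds** (p1 g13). [this work] -/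
theorem twoBigCertJ_holds' : TwoBigCertJ := TwoBigJProof.twoBigCertJ_holds

/-- **Lead g19's honest-F2 certificate `TwoBigCert` holds** (`twoBigCert_of_J`). [this work] -/
theorem twoBigCert_holds_of_J : TwoBigCert := twoBigCert_of_J TwoBigJProof.twoBigCertJ_holds

/-- **T-DIB: Conjecture DIB\* holds at every floor `x < 1`** — `dibStar_of_twoBigCertJ TwoBigJProof.twoBigCertJ_holds`: CELL F1 (lead g19,
`RootDec.tail_ge_of_oneBig`) + the j-cloud two-big certificate (this seat) on the open class `StepLemmaFSTwoBigs` (p275161), which is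
equivalent to `∀ x < 1, DIBStar x` by the floor-split induction of lead g17/g18 (`stepLemmaFSTwoBigs_iff_dibStar`).  With this, DIB\* — the single
probabilistic ingredient of the R8 architecture (README V185) — is a kernel theorem. [this work] -/
theorem dibStar_holds_J (x : ℝ) (hx1 : x < 1) : DIBStar x := dibStar_of_twoBigCertJ TwoBigJProof.twoBigCertJ_holds x hx1

end IndepBlob
end Quant
end Summit.CriticalPhenomena.PercolationContinuityZ3.Theorems
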